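import Summits.QuantumAdvantage.QuantumAdvantage.Theorems.DigitRung.Negative.NoTwoAdicBias

/-!
# `DigitRung` (stmt-QuantumAdvantage-2423) — the digit phase is non-degenerate: `det Hess(Disc) = 3888·Disc²` (negative-side support)

The Hessian determinant of the binary cubic discriminant `Disc(a,b,c,d) = b²c² − 4ac³ − 4b³d −
27a²d² + 18abcd` is `3888·Disc²` (`3888 = 2⁴·3⁵`; prehomogeneity: `Disc` is the unique relative
invariant of `GL₂ ↷ Sym³`, so the relative invariant `det Hess(Disc)` is a constant multiple of
`Disc²`). Hence the additive "digit phase" `e(r·Disc(x)/q)` of crux `DigitRung` has non-degenerate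
Hessian exactly off the discriminant locus — the algebraic input of the stationary-phase /
square-root heuristic for the complete sums `Σ_{x mod q} e((r·Disc x + ⟨x, w⟩)/q)` in the refuter's
assessment (`Cruxes/DigitRung/Disproof.lean`) and the lever claimed by crux idea
`hessian-poisson-upper-band`, confirmed here by `ring`.

* `hessCubicDisc`, `det_hessCubicDisc`.
-/

namespace Summit.QuantumAdvantage.DigitRung.Negative

/-- The Hessian matrix of `cubicDisc a b c d` with respect to `(a, b, c, d)`. -/
def hessCubicDisc {R : Type*} [CommRing R] (a b c d : R) : Matrix (Fin 4) (Fin 4) R :=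
  !![-54 * d ^ 2, 18 * c * d, -12 * c ^ 2 + 18 * b * d, -108 * a * d + 18 * b * c;
     18 * c * d, 2 * c ^ 2 - 24 * b * d, 4 * b * c + 18 * a * d, -12 * b ^ 2 + 18 * a * c;
     -12 * c ^ 2 + 18 * b * d, 4 * b * c + 18 * a * d, 2 * b ^ 2 - 24 * a * c, 18 * a * b;
     -108 * a * d + 18 * b * c, -12 * b ^ 2 + 18 * a * c, 18 * a * b, -54 * a ^ 2]

/-- **`det Hess(Disc) = 3888 · Disc²`.** [folklore] -/
theorem det_hessCubicDisc {R : Type*} [CommRing R] (a b c d : R) :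
    (hessCubicDisc a b c d).det = 3888 * (cubicDisc a b c d) ^ 2 := by
  unfold hessCubicDisc cubicDisc
  rw [Matrix.det_succ_row_zero]
  simp [Fin.sum_univ_succ, Matrix.det_fin_three, Matrix.submatrix_apply, Fin.succAbove]
  ring

end Summit.QuantumAdvantage.DigitRung.Negative
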